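import Summits.ABC.IUTFork.Cor312ReadingIso
import Summits.ABC.IUTFork.Cor312PinnedLogShell
import Summits.ABC.IUTFork.Cor312PinnedHonestInflationNV
import Summits.ABC.IUTFork.Repair.CandJoshi9
import Summits.ABC.IUTFork.Repair.CandMochizuki40
import HarnessLib

/-!
# R-H candidate H⋆ — lens `dual` (seat abc-iut-lens-dual-3): the LABEL-GLOBAL reading of Step (xi)

[R-H candidate, hypothesis — not a fact]  D-0079 RESCUE.H (rung A2 I06/I06⋆ of LADDER-ABC).
Nothing here asserts that abc is proved or refuted; no side is taken on [IUTchIII] Cor. 3.12 or on any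
author; typed ≠ proved ≠ endorsed.  `HStarLabelGlobal` is a claim-tagged HYPOTHESIS on a
`Cor312.Setting` (bed-agnostic: instantiate `P` at the genuine sharp bed
`Thm311.Real.settingPrVolSharp (Cor312Prov.pilotDataOfK …) …` or at any other setting of record).

DUALITY USED (order of aggregation).  The Step (xi) volume data of a setting `P` is a matrix of local
numbers indexed by (label `j ∈ 𝔽_l^⋇`, place `v_ℚ`): `qLocal j v` and `thetaLocal j v`.  The printed
Statement compares the two after BOTH aggregations (finsum over places, procession-average over labels).
Two marginal readings sit strictly between the packetwise reading (READING 0, `statement_of_qLocal_le`,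
refuted at every deep packet: `Cor312PinnedPacketwiseBarrier`) and the Statement:
* per PLACE, label-averaged — `Repair.CandMochizuki40.Placewise` (fails at a deep place: (EssGlIq));
* per LABEL, place-summed — THIS candidate (the transpose marginal; keeps the cross-place compensation
  by good-place shell inflation that (EssGlIq) says is essential, drops only cross-label compensation).

k2 (glue, sorry-free below): `HStarLabelGlobal P → P.ThetaFinite → P.Statement`
(`statement_of_hStarLabelGlobal`; with the bridge hypotheses of record: `statement_of_hStarLabelGlobal'`).
Positioning: READING 0 ⇒ H⋆ (`hStarLabelGlobal_of_qLocal_le`), so H⋆ is weaker than every packetwise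
supplier (I06, I06⋆-readings, IsoContainment, licence) and stronger than the Statement.

§2 (k4 / (H1) witnesses in the kernel, on abc-iut-w4-d103's one-place log-shell bed `PinnedHonest.shellSetting p d`,
`l⋆ = 2`, `q = p`, Θ-images `B_{j²−d}`): `hStarLabelGlobal_shellSetting_iff : H⋆ ↔ 3 ≤ d` (= the licence there,
`shell_licence_iff` — ONE place, so no cross-place compensation is available and H⋆ collapses to the packetwise cell,
as the CARD predicts), while `shell_statement_iff : Statement ↔ 3 ≤ 2d`; hence at `d = 2`: **Statement ∧ ¬H⋆**
(`statement_and_not_hStarLabelGlobal_shellSetting_two`) — H⋆ is NOT Statement-strength (k4 (b)), and its truth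
GROWS with the inflation `d` (false `d ≤ 2`, true `d ≥ 3`: `hStarLabelGlobal_shellSetting_three`,
`not_hStarLabelGlobal_shellSetting_two`) — BARRIER-SCREEN (H1) test «evaluate at shellSetting p d, d = 0..4;
constant ⇒ KILLED» passed by name.
-/

noncomputable section

namespace Summit.ABC.IUTFork.Repair.RH.LabelGlobal

open Thm311 Cor312 Cor312Vol

variable {T : ThetaIndex} {S : Situation T}

/-- [R-H candidate, hypothesis — not a fact]  **H⋆ (label-global reading of Step (xi)).**  At every label
`j = i+1 ∈ 𝔽_l^⋇` the GLOBAL (summed over all `v_ℚ`) log-volume of the `q`-pilot at label `j` is at most the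
GLOBAL log-volume of the holomorphic hull of the possible images of the Θ-pilot at label `j`:
`∑_v qLocal j v ≤ ∑_v logvol(^{n,∘}𝒰_{j,v})` for each `j` separately (no procession average).  Honest
leading-order content on genuine data (packet reading, `(j+1)` tensor slots): with `η` = normalised bad
`q`-mass and `Δ` = normalised one-slot shell inflation summed over ALL ramified places of `K`,
`labelSum_j ≈ (j+1)·Δ − (j²−1)·η`, binding at the top label `j = l⋆`: `(l⋆−1)·η ≤ Δ` — versus the
Statement's `η ≤ 3(l⋆+3)/((2l⋆+5)(l⋆−1))·Δ`; i.e. H⋆ costs the constant factor `(2l⋆+5)/(3(l⋆+3)) → 2/3`,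
not a power of `l`.  [claim: Mochizuki2012, status: disputed] (hypothesis; never asserted) -/
@[claim "Mochizuki2012" "disputed"]
def HStarLabelGlobal (P : Cor312.Setting S) : Prop :=
  ∀ i : Fin T.lstar,
    ∑ᶠ vQ : T.VQ, P.qLocal (Setting.labelSucc i) vQ ≤
      ∑ᶠ vQ : T.VQ, (P.thetaLocal (Setting.labelSucc i) vQ).untopD 0

variable {P : Cor312.Setting S}

/-- **k2 glue (door (b)): H⋆ ⟹ the printed Statement**, under the finiteness `ThetaFinite` of record
(`−|log(Θ)| ∈ ℝ`): `−|log(q)| = procession-average of the per-label global `q`-volumes ≤ procession-average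
of the per-label global hull volumes = `−|log(Θ)|`, by `processionNormalized_mono`.  Five lines; no `ρ`, no
constant-representation degeneracy; valid at every `Cor312.Setting`, the genuine sharp bed included.
[claim: Mochizuki2012, status: disputed] (conditional on the hypotheses named) -/
theorem statement_of_hStarLabelGlobal (hfin : P.ThetaFinite) (h : HStarLabelGlobal P) : P.Statement := by
  constructor
  · unfold Setting.negLogTheta
    rw [if_pos hfin]
    exact WithTop.coe_ne_top
  · unfold Setting.negLogTheta
    rw [if_pos hfin, WithTop.coe_le_coe]
    unfold Setting.negLogQ
    exact processionNormalized_mono fun i => h i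

/-- k2 glue with the bridge hypotheses of record (`BridgeHyps` carries `ThetaFinite`).
[claim: Mochizuki2012, status: disputed] (conditional on the hypotheses named) -/
theorem statement_of_hStarLabelGlobal' (H : BridgeHyps P) (h : HStarLabelGlobal P) : P.Statement :=
  statement_of_hStarLabelGlobal H.finite h

/-- **Positioning: READING 0 (packetwise volumes) ⟹ H⋆.**  Summing the packetwise inequality over the
(finitely supported) places.  Hence H⋆ is implied by every packetwise supplier of the R-H table (I06-type
inclusions give READING 0 via `LogvolMono`), and the packetwise barrier
(`Cor312PinnedPacketwiseBarrier.pointwiseSupplier_false_of_deep_packet`) does not apply to H⋆: a deep packet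
at one place can be paid for by shell inflation at the other places OF THE SAME LABEL. [folklore] -/
theorem hStarLabelGlobal_of_qLocal_le (hfin : P.ThetaFinite)
    (h : ∀ (i : Fin T.lstar) (vQ : T.VQ),
      P.qLocal (Setting.labelSucc i) vQ ≤ (P.thetaLocal (Setting.labelSucc i) vQ).untopD 0) :
    HStarLabelGlobal P := fun i =>
  finsum_le_finsum' (P.qSupport_finite (Setting.labelSucc i)) (hfin.2 i) fun vQ => h i vQ

/-- **Positioning: H⋆ is a per-label family of GLOBAL inequalities; the Statement is their procession
average.**  Equivalent packaging: H⋆ says the minimum over labels of the global slack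
`Θ_j − Q_j := ∑_v thetaLocal j v − ∑_v qLocal j v` is `≥ 0`, the Statement (given `ThetaFinite`) that its
average is `≥ 0`. [folklore] -/
theorem hStarLabelGlobal_iff_slack_nonneg :
    HStarLabelGlobal P ↔ ∀ i : Fin T.lstar,
      0 ≤ (∑ᶠ vQ : T.VQ, (P.thetaLocal (Setting.labelSucc i) vQ).untopD 0) -
        ∑ᶠ vQ : T.VQ, P.qLocal (Setting.labelSucc i) vQ := by
  simp only [HStarLabelGlobal, sub_nonneg]

/-! ## 2. Kernel witnesses on the one-place log-shell bed `PinnedHonest.shellSetting p d` (k4 (b), (H1)) -/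

section Beds

open Cor312.Checks Cor312.IdentifiedNonVacuity Cor312Vol.NaiveWitness Cor312Vol.PinnedWitness Cor312Vol.PinnedHonest

variable (p : ℕ) [hp : Fact p.Prime] (d : ℕ)

-- (dedup) the q-side value `(shellSetting p d).qLocal (labelSucc i) vQ = -log p` is the LANDED
-- `Summit.ABC.IUTFork.Repair.CandJoshi9.shell_qLocal` (imported; not restated here).

/-- The per-label GLOBAL slack of `shellSetting p d` at label `j = i+1`: `Θ_j − Q_j = (1 + d − j²)·log p` (one place, so the
"sum over places" is the single packet). [folklore] -/
theorem shell_labelSlack (i : Fin toyIndex.lstar) :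
    (∑ᶠ vQ : toyIndex.VQ, ((shellSetting p d).thetaLocal (Setting.labelSucc i) vQ).untopD 0) -
        ∑ᶠ vQ : toyIndex.VQ, (shellSetting p d).qLocal (Setting.labelSucc i) vQ =
      (1 + (d : ℝ) - (jsq (Setting.labelSucc i) : ℝ)) * Real.log p := by
  simp only [shell_thetaLocal, CandJoshi9.shell_qLocal, finsum_unique, WithTop.untopD_coe]
  push_cast
  ring

/-- **H⋆ on the one-place log-shell bed is the height inequality `3 ≤ d`** (binding label `j = 2`: `4 − d ≤ 1`); by
`shell_licence_iff` this is exactly the (xi-f) licence there — with ONE place there is nothing to compensate with, so the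
label-global reading collapses to the packetwise cell, as predicted. [folklore] -/
theorem hStarLabelGlobal_shellSetting_iff : HStarLabelGlobal (shellSetting p d) ↔ 3 ≤ d := by
  have hl := log_p_pos p
  rw [hStarLabelGlobal_iff_slack_nonneg]
  simp only [shell_labelSlack]
  have h2 : jsq (Setting.labelSucc (T := toyIndex) ⟨1, by decide⟩) = 4 := by decide
  have hle : ∀ i : Fin toyIndex.lstar, jsq (Setting.labelSucc i) ≤ 4 := by decide
  constructor
  · intro h
    have h4 := h ⟨1, by decide⟩
    rw [h2] at h4
    push_cast at h4
    by_contra hd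
    have hd' : (d : ℝ) ≤ 2 := by exact_mod_cast Nat.lt_succ_iff.mp (not_le.mp hd)
    nlinarith
  · intro hd i
    have hd' : (3 : ℝ) ≤ d := by exact_mod_cast hd
    have hj : (jsq (Setting.labelSucc i) : ℝ) ≤ 4 := by exact_mod_cast hle i
    have hfac : 0 ≤ 1 + (d : ℝ) - (jsq (Setting.labelSucc i) : ℝ) := by linarith
    exact mul_nonneg hfac hl.le

/-- H⋆ ⟺ the (xi-f) licence on this bed (`shell_licence_iff`). [folklore] -/
theorem hStarLabelGlobal_shellSetting_iff_licence :
    HStarLabelGlobal (shellSetting p d) ↔ Thm311ToCor312.Licence (shellSetting p d) := by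
  rw [hStarLabelGlobal_shellSetting_iff, shell_licence_iff]

/-- (H1) test, lower end: H⋆ FAILS at `d = 2`. [folklore] -/
theorem not_hStarLabelGlobal_shellSetting_two : ¬ HStarLabelGlobal (shellSetting p 2) := by
  rw [hStarLabelGlobal_shellSetting_iff]; decide

/-- (H1) test, upper end: H⋆ HOLDS at `d = 3` — its truth grows with the inflation `d` (not inflation-blind). [folklore] -/
theorem hStarLabelGlobal_shellSetting_three : HStarLabelGlobal (shellSetting p 3) := by
  rw [hStarLabelGlobal_shellSetting_iff]

/-- **k4 (b) in the kernel: H⋆ is NOT Statement-strength.** At `d = 2` the typed Corollary HOLDS (`shell_statement_iff`: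
`3 ≤ 4`) while H⋆ FAILS (label sums `(2, −1)·log p`: average `½·log p ≥ 0`, minimum `< 0`). [folklore] -/
theorem statement_and_not_hStarLabelGlobal_shellSetting_two :
    (shellSetting p 2).Statement ∧ ¬ HStarLabelGlobal (shellSetting p 2) :=
  ⟨(shell_statement_iff p 2).2 (by decide), not_hStarLabelGlobal_shellSetting_two p⟩

end Beds

/-! ## 3. Row 22 vs the PLACE marginal (`Repair.CandMochizuki40.Placewise`, the per-place label-AVERAGED reading of rows
11/23 type): NOT dominated — kernel witnesses on the same bed (v2 append, row-22 typer abc-iut-rh-typ-6) -/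

section PlaceMarginal

open Cor312.Checks Cor312Vol.PinnedHonest Summit.ABC.IUTFork.Repair.CandMochizuki40

variable (p : ℕ) [hp : Fact p.Prime] (d : ℕ)

/-- On the one-place log-shell bed the PLACE marginal `Placewise` (local portion at every place, labels averaged) collapses to the
Statement (abc-iut-rp-m4's `placewise_iff_statement_onePlace`), i.e. to the height inequality `3 ≤ 2d` (`shell_statement_iff`). [folklore] -/
theorem placewise_shellSetting_iff : Placewise (shellSetting p d) ↔ 3 ≤ 2 * d := by
  rw [placewise_iff_statement_onePlace]
  exact shell_statement_iff p d

/-- **Row 22 is NOT implied by the place marginal**: at `d = 2` the place-marginal reading `Placewise` HOLDS (`3 ≤ 4`) while the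
label-marginal H⋆_22 FAILS (`¬ 3 ≤ 2`; label slacks `(2, −1)·log p`).  So `Placewise → HStarLabelGlobal` is false in general: the
label marginal keeps information (the per-label sign) that the place marginal averages away — row 22 is not mergeable into a
place-marginal row by implication. [folklore] -/
theorem placewise_and_not_hStarLabelGlobal_shellSetting_two :
    Placewise (shellSetting p 2) ∧ ¬ HStarLabelGlobal (shellSetting p 2) :=
  ⟨(placewise_shellSetting_iff p 2).2 (by decide), not_hStarLabelGlobal_shellSetting_two p⟩

/-- On this ONE-place bed the converse direction is automatic (`3 ≤ d → 3 ≤ 2d`): H⋆_22 ⟹ `Placewise`; a bed separating the other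
way (H⋆_22 true, `Placewise` false) needs TWO places — a deep place compensated, at the same label, by a good place's inflation —
and is not constructed here. [folklore] -/
theorem placewise_of_hStarLabelGlobal_shellSetting (h : HStarLabelGlobal (shellSetting p d)) : Placewise (shellSetting p d) := by
  rw [placewise_shellSetting_iff]
  have hd := (hStarLabelGlobal_shellSetting_iff p d).1 h
  omega

end PlaceMarginal

/-! ## 4. Round-2 doors for the k1 column (bed-agnostic): H⋆_22 against per-place CAPACITY upper bounds and REACH lower bounds
(v3 append, row-22 typer abc-iut-rh-typ-6).  The k1 recipe of record (bus 18:42:50Z) evaluates, per datum and label, a place-sum of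
certified per-packet bounds; these two lemmas are the kernel shape that recipe instantiates: any finitely supported family of per-place
upper bounds `cap v ≥ thetaLocal (j, v)` whose place-sum drops below the `q`-sum at ONE label refutes H⋆_22; any family of lower bounds
`reach (j, v) ≤ thetaLocal (j, v)` whose place-sums dominate the `q`-sums at EVERY label proves it. -/

section Doors

variable {P : Cor312.Setting S}

/-- **NEG door (capacity form).**  If at some label `j = i+1` a finitely supported per-place upper bound `cap` of the hull volumes
(`thetaLocal (j, v) ≤ cap v` for every `v_ℚ`) has place-sum strictly below the place-sum of the `q`-pilot volumes at that label, then
H⋆_22 fails.  (Instantiate `cap` with any certified container bound — explicit depth, sharp shell radius, … — at the bad packets and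
with the pure shell inflation at the good ramified ones.) [folklore] -/
theorem not_hStarLabelGlobal_of_capSum_lt (hfin : P.ThetaFinite) (i : Fin T.lstar) (cap : T.VQ → ℝ)
    (hcap : ∀ vQ, (P.thetaLocal (Setting.labelSucc i) vQ).untopD 0 ≤ cap vQ) (hsupp : (Function.support cap).Finite)
    (hlt : ∑ᶠ vQ : T.VQ, cap vQ < ∑ᶠ vQ : T.VQ, P.qLocal (Setting.labelSucc i) vQ) : ¬ HStarLabelGlobal P := fun h =>
  absurd ((h i).trans (finsum_le_finsum' (hfin.2 i) hsupp hcap)) (not_le.mpr hlt)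

/-- **POS door (reach form).**  If at every label `j = i+1` a finitely supported per-place lower bound `reach i` of the hull volumes
(`reach i v ≤ thetaLocal (j, v)`) has place-sum at least the place-sum of the `q`-pilot volumes, then H⋆_22 holds — under
`ThetaFinite` (finite supports on the Θ-side).  (Instantiate `reach` with mover / level reaches at the bad packets, `0` or the certified
inflation at the good ones.) [folklore] -/
theorem hStarLabelGlobal_of_qSum_le_reachSum (hfin : P.ThetaFinite) (reach : Fin T.lstar → T.VQ → ℝ)
    (hreach : ∀ i vQ, reach i vQ ≤ (P.thetaLocal (Setting.labelSucc i) vQ).untopD 0)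
    (hsupp : ∀ i, (Function.support (reach i)).Finite)
    (hle : ∀ i, ∑ᶠ vQ : T.VQ, P.qLocal (Setting.labelSucc i) vQ ≤ ∑ᶠ vQ : T.VQ, reach i vQ) : HStarLabelGlobal P := fun i =>
  (hle i).trans (finsum_le_finsum' (hsupp i) (hfin.2 i) (hreach i))

/-- **NEG door, slack form** (the shape the k1 column of record evaluates: rh-num-1's place-summed bad slacks 18:38:02Z plus a
good-place capacity term): with a per-place hull-volume bound `cap` and the exact `q`-volumes both supported on ONE finite set `s` of
places, a negative finite sum of the per-place slacks `cap v − qLocal (j, v)` over `s` at some label `j` refutes H⋆_22. [folklore] -/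
theorem not_hStarLabelGlobal_of_sum_slack_lt (hfin : P.ThetaFinite) (i : Fin T.lstar) (cap : T.VQ → ℝ)
    (hcap : ∀ vQ, (P.thetaLocal (Setting.labelSucc i) vQ).untopD 0 ≤ cap vQ) (s : Finset T.VQ)
    (hcapS : Function.support cap ⊆ s) (hqS : Function.support (fun vQ => P.qLocal (Setting.labelSucc i) vQ) ⊆ s)
    (hlt : ∑ vQ ∈ s, (cap vQ - P.qLocal (Setting.labelSucc i) vQ) < 0) : ¬ HStarLabelGlobal P := by
  refine not_hStarLabelGlobal_of_capSum_lt hfin i cap hcap (s.finite_toSet.subset hcapS) ?_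
  rw [finsum_eq_sum_of_support_subset _ hcapS, finsum_eq_sum_of_support_subset _ hqS]
  have := Finset.sum_sub_distrib (s := s) (f := cap) (g := fun vQ => P.qLocal (Setting.labelSucc i) vQ)
  linarith

end Doors

end Summit.ABC.IUTFork.Repair.RH.LabelGlobal

end
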